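import Literature.Claims.NS.ClayVariants
import Literature.Analysis.FluidPDE.VectorCalculus
import Literature.Analysis.FluidPDE.ClayClassLerayHopfUniqueness
import Literature.Analysis.FluidPDE.FiniteEnergyClassicalL2Decay
import HarnessLib

/-!
# Claim skeleton (D-0090 NS-CLAIMS, C98; T3, QUICK grain): Aranda Icardo 2025 — «Unique solution to
# the Navier-Stokes equations in three dimensions» (formal time-power series ⇒ uniqueness; under
# `(u·∇)u = 0` at `t = 0` ⇒ «entire» series ⇒ global smooth solution; energy decay)

Typed skeleton of Heber S. Aranda Icardo («By Heber Aranda» on the PDF), *Unique solution to the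
Navier-Stokes equations in three dimensions*, OSF Preprints record `b9ghr` VERSION 1 (2025-05-19, 6 pp.,
PDF page = printed page, sha16 f03f2ead52d00463) = bib `ArandaIcardo2025`, the text of record of cell
`ns-claims` row C98 (pinned by ns-claims-census-1 g4 from the OSF public API:
`run/shared/lean/pub/ns-claims/census/texts/ArandaIcardo2025/`, pointer `sources/ArandaIcardo2025/LOCATORS.md`).
Earlier records `q4n3f` v1 (2025-05-08) / v2 (2025-05-12, 4 pp., doi:10.31219/osf.io/q4n3f_v2) carry the
same title and abstract; VERSION DELTA at the decisive place: `q4n3f` v2 §4 «Convergence» asserts the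
factorial majorants and the convergence of the series «for all t ∈ ℝ» for GENERAL smooth decaying data and
has no energy section; `b9ghr` v1 (typed here) opens §4 with the added datum hypothesis «(u·∇)u = 0 at
t = 0» (p.3 l.1–2), adds the energy computation pp.4–5 and the §5 «Conclusion» p.5. UNREFEREED CLAIM under
adjudication — NOTHING in this file asserts a step of the paper: the paper's statements are `def … : Prop`;
the `theorem`s are the kernel compositions of the paper's own chains and the Clay plumbing.

## The claimed statements, as printed
* UNIQUENESS (title; abstract p.1 l.4–6 «For initial datum of finite kinetic energy. In this paper prove
  that solution of the 3D Navier-Stokes equations is unique for incompressible fluids with zero external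
  force.»; §3 «Uniqueness argument» p.2 l.34–64 «… ⇒ u_{i,h+1}(x) is unique … We then obtain: u_{0i} →
  u_{i,1}, p_0 → u_{i,2}, p_1 → ⋯ ; u_i = u_{0i}(x) + Σ_{h≥1} u_{i,h}(x) t^h, p = Σ_{h≥0} p_h(x) t^h with
  |∂^α_x u₀(x)| ≤ C_{αK}(1 + |x|)^{−K}, ∀α, K on ℝ³») — `ClaimedUniqueness`.
* EXISTENCE (§5 «Conclusion» p.5 l.58–73 «Under the conditions: Given a smooth initial velocity field that
  decays sufficiently fast at infinity. Incompressible, viscous fluid (ν > 0), No external forces. Finite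
  initial kinetic energy, the kinetic energy decays over time and: lim_{t→∞} ∫_{ℝ³}|u(x,t)|² dx = 0, that
  is, the velocity field tends to 0 in L² norm as t → ∞. The convective acceleration is assumed to be
  zero for the initial condition (u·∇)u = 0 at t = 0[.] There exists a smooth (regular) solution to the
  three-dimensional Navier–Stokes equations for all positive time.») — `ClaimedExistence` (the last
  sentence, under all listed conditions) and `ClaimedDecay` (the energy sentence).
TYPED on `ℝ³`, `f ≡ 0`, every `ν > 0` (p.1 (1)–(3), p.1 l.43–50 «u₀(x) is a given smooth function … ν
is a positive coefficient»), data = `IsDatum` (smooth, divergence-free — (2) at `t = 0` —, Clay decay (4)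
as printed on p.2 l.65–69; this implies the abstract's «finite kinetic energy»), «solution» =
`IsGlobalSolution` (smooth on `ℝ³ × [0,∞)`, solves (1)–(3) with `f ≡ 0`, bounded kinetic energy — the
print's p.5 `E(t) ≤ E(0)`; token for token the body of `ClayVariants.clayR3.Solvable`,
`isGlobalSolution_iff_solvable`).

## Delta to Clay (`ClayVariants` §2 matrix)
* `ClaimedUniqueness`: direction OTHER — uniqueness is not one of (A)–(D); no `clay_of_…` is typable.
  Δ4: the abstract's class «finite kinetic energy» (Leray–Hopf scale) is WIDER than the typed Clay data
  (4) which §2–§3 actually use (p.1 l.43, p.2 l.65–69); at the abstract's own class uniqueness of weak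
  solutions is an open question in print (and fails with forcing) — not typed, recorded.
* `ClaimedExistence`: (A)-shaped — Δ1 `ℝ³` = · Δ2 NS (1)–(2) = · Δ3 `f ≡ 0` = · **Δ4 data = Clay (4) ∩
  {(u₀·∇)u₀ = 0}** (a RESTRICTED class; `claimedExistence_of_clay : clayR3.Regularity → ClaimedExistence`,
  the converse is not claimed by the print and not typable) · Δ5 smooth on `ℝ³ × [0,∞)` + bounded energy
  = (6)(7) ✓ · Δ6 conclusion = existence ✓ · Δ7 every `ν > 0` ✓. Typist's remark for the refuter (CARD
  §4 PREDICTION, not asserted here): a smooth, divergence-free, rapidly decreasing field with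
  `(u₀·∇)u₀ ≡ 0` has `∫ u₀ᵢ u₀ⱼ = −∫ xⱼ div(u₀ᵢ u₀) = 0`, hence is `≡ 0` — the same datum hypothesis as
  C113 `Baev2022` (11) (`Literature.Claims.NS.Baev2022.Cond11`, verbatim the body of `ConvectiveZero`).

## Ordered Step index (print order; `[cite]` locators are PDF = printed pages of `b9ghr` v1)
* Step 1 = `Step_1` — §2 p.1 l.51–60 «The equations can be solved in Taylor series form: u_i = u_{0i}(x)
  + Σ_{h=1}^∞ u_{i,h}(x) t^h, p = Σ_{h=0}^∞ p_h(x) t^h» (restated p.2 l.54–64 as the outcome of §3): the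
  ANSATZ / REPRESENTATION step — every solution issued from `u₀` is the sum, for `t ≥ 0`, of a
  time-power series whose coefficients obey the recursion (4)–(5). LOAD-BEARING for uniqueness
  (implicit identification of a solution with its formal time-Taylor series at `t = 0`).
* Step 2 = `Step_2` — §2 p.2 l.1–33 (recursion (4)–(5), «Assuming u₀(x) is smooth, then u_{i,h+1}(x) and
  F(x) are smooth functions») with §3 p.2 l.40–53 (the Newtonian potential «p_h(x) = −(1/4π)∫ F(η)/‖η−x‖
  d³η + c … assuming physically reasonable solutions where u₀(x) → 0 sufficiently quickly at infinity»):
  the recursion is solvable — a Taylor system exists for every datum.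
* Step 3 = `Step_3` — §3 p.2 l.35–39 «Consider an arbitrary smooth region V ⊂ ℝ³ with values of u(x,t)
  specified on ∂V. Then, the values of ∇p_h are specified on ∂V (Neumann boundary conditions). The
  solution of Δp_h = F is unique (up to an additive constant), p_h(x) = f(x) + c ⇒ u_{i,h+1}(x) is unique»
  + l.54–55 «u_{0i} → u_{i,1}, p_0 → u_{i,2}, p_1 → ⋯»: the velocity coefficients are uniquely determined
  by `u₀` (pressures up to additive constants). TRUE-type as typed with the print's decaying-pressure
  selection (Liouville for harmonic functions with vanishing gradient at infinity — cf. the PROVED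
  `…Theorems.Baev2022.step2_neumannLiouville_holds`); not proved here.
* Step 4 = `Step_4` — §4 pp.3–4 (p.3 l.1–2 «If the convective acceleration is assumed to be zero for the
  initial condition: (u·∇)u = 0 at t = 0»; l.3–46 the structural formula and the majorant «u_{i,h+1} ≤
  (1/(h+1))(Ā_{h+1}/h! + C̄_{h+1}D̄_{h+1}/(h−1)!!)», «The coefficients Ā_{h+1}, C̄_{h+1}, and D̄_{h+1}
  belong to ℝ and depend only on the initial conditions»; l.47–59 «there exist positive real numbers a,
  b, c, d, f such that: a ≥ C̄_h for all even h …»; p.3 l.60–p.4 l.76 «Σ_h μ_{i,h} t^h ≤ N(t) … N(t)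
  converges for all t ∈ ℝ»): under the datum hypothesis the velocity series converges for every `t`.
* Step 5 = `Step_5` — IMPLICIT between §4 and §5 p.5 l.73 («There exists a smooth (regular) solution to
  the three-dimensional Navier–Stokes equations for all positive time»; = the existence reading of the
  ansatz sentence p.1 l.51 «The equations can be solved in Taylor series form»): the sum of the convergent
  series is a smooth, bounded-energy solution of (1)–(3) on `ℝ³ × [0,∞)` for some pressure (term-wise
  differentiation, smoothness and energy of the sum — unprinted).
* Step 6 = `Step_6` — p.4 l.77–p.5 l.35 (scalar product with `u`, «∫(u·∇)u·u dx = 0, (by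
  incompressibility)», «∫∇p·u dx = −∫p∇·u dx = 0», «ν∫Δu·u dx = −ν∫|∇u|² dx, (by integration by parts)»,
  «dE/dt = −ν∫|∇u|² dx ≤ 0. This shows that the kinetic energy does not increase»): along every global
  solution the energy is non-increasing (integrated form). TRUE-type (Leray) — under integrability
  hypotheses the print does not state; not proved here.
* Step 7 = `Step_7` — p.5 l.36–56 («Since E(t) is decreasing and bounded below by 0, it converges …
  ∫₀^∞∫|∇u|² dx dt < ∞ … Moreover, assuming some additional regularity (such as the global existence of a
  smooth solution, which is not yet proven in general), one can deduce that: lim_{t→∞} ‖u(·,t)‖_{L²} =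
  0»): along every global smooth solution the energy tends to `0`. TRUE-type (L²-decay of finite-energy
  solutions on `ℝ³`); hedged in print; not load-bearing for the adjudication.
COMPOSITION (both PROVED below): `claimU_of_steps : Step_1 → Step_3 → ClaimedUniqueness` (§3: two
solutions from the same datum are sums of Taylor systems, whose velocity coefficients coincide);
`claimE_of_steps : Step_2 → Step_4 → Step_5 → ClaimedExistence` (§2 + §4 + §5); `claimD_of_steps :
Step_6 → Step_7 → ClaimedDecay`. Step 2 is not needed by the uniqueness chain (Step 1 supplies a system
for each solution) — recorded, harmless.

## References
* H. S. Aranda Icardo, OSF Preprints b9ghr v1 (`ArandaIcardo2025`): abstract p.1; (1)–(3) p.1; §2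
  (4)–(5) pp.1–2; §3 p.2; §4 pp.3–4; energy pp.4–5; §5 p.5; references p.6.
* Cell files: `claims/ArandaIcardo2025/CARD.md` (typist-3 g3; PREDICTION 2026-08-27T02:55:40Z, informed by
  the census structure note, blind on the pages — CARD sha16 ddc778f9da5d5355),
  `census/texts/ArandaIcardo2025/README.txt` (census-1 g4), `sources/ArandaIcardo2025/LOCATORS.md`.
* Cross-claim: `Literature.Claims.NS.Baev2022` (C113) condition (11) `Cond11` = `ConvectiveZero` verbatim.

WHAT THIS IS NOT: not a claim about NS regularity or blow-up; not a claim about any author beyond the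
typed locator.
-/

noncomputable section

open Set MeasureTheory Filter Topology
open scoped ContDiff ENNReal
open Laplacian

namespace Literature.Claims.NS.ArandaIcardo2025

open Literature.Analysis.FluidPDE Literature.Claims.NS.ClayVariants

/-- Physical space `ℝ³` (p.1 (1)–(3): «x ∈ ℝ³»). [folklore] -/
abbrev E3 : Type := EuclideanSpace ℝ (Fin 3)

/-! ## Vocabulary of the print -/

/-- The datum class the argument works with: `u₀` smooth (p.1 l.43 «u₀(x) is a given smooth function»),
divergence-free ((2) at `t = 0`), with Clay's decay (4) (p.2 l.65–69 «|∂^α_x u₀(x)| ≤ C_{αK}(1 + |x|)^{−K},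
∀α, K on ℝ³»; §5 p.5 l.59 «a smooth initial velocity field that decays sufficiently fast at infinity»).
This implies the abstract's «finite kinetic energy». Verbatim the body of `Literature.Claims.NS.Baev2022.IsDatum`.
[cite: ArandaIcardo2025, p.1 l.43; p.2 l.65–69; §5 p.5 l.58–62] -/
def IsDatum (u₀ : E3 → E3) : Prop :=
  ContDiff ℝ ∞ u₀ ∧ NSWave0.IsDivFree u₀ ∧ HasRapidSpatialDecay u₀

/-- The added datum hypothesis of §4 and §5: «the convective acceleration is assumed to be zero for the
initial condition: (u·∇)u = 0 at t = 0» — `(u₀·∇)u₀ ≡ 0` on `ℝ³`. Verbatim the body of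
`Literature.Claims.NS.Baev2022.Cond11` (C113, condition (11)). [cite: ArandaIcardo2025, §4 p.3 l.1–2; §5 p.5 l.71–72] -/
def ConvectiveZero (u₀ : E3 → E3) : Prop :=
  ∀ x : E3, convect u₀ u₀ x = 0

/-- «Solution» in the print's sense, made precise at Clay's grain: `u`, `p` smooth on `ℝ³ × [0,∞)`,
solving (1)–(3) with `f ≡ 0` and datum `u₀` (p.1), with bounded kinetic energy (p.5 l.21–35
«E(t) = ½∫|u(x,t)|² dx … does not increase»; Clay (6)(7)). Token for token the body of
`ClayVariants.clayR3.Solvable ν 0 u₀` (`isGlobalSolution_iff_solvable`).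
[cite: ArandaIcardo2025, (1)–(3) p.1; p.5 l.21–35; §5 p.5 l.73] -/
def IsGlobalSolution (ν : ℝ) (u₀ : E3 → E3) (u : ℝ → E3 → E3) (p : ℝ → E3 → ℝ) : Prop :=
  IsSmoothOnHalfSpace u ∧ IsSmoothOnHalfSpace p ∧ IsNavierStokesSolution ν 0 u₀ u p ∧ HasBoundedEnergy u

/-- The kinetic energy `∫|u(x,t)|² dx` (p.4 l.77–80, p.5 l.21–25; the print's `E(t)` carries a factor
`½`, immaterial for monotonicity and limits), as an extended non-negative real (no junk value).
[cite: ArandaIcardo2025, p.5 l.21–25] -/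
def energy (u : ℝ → E3 → E3) (t : ℝ) : ℝ≥0∞ :=
  ∫⁻ x, ‖u t x‖ₑ ^ 2

/-- **The recursion (4)–(5) of §2** for the coefficients of the ansatz `u = Σ_{h≥0} u_h t^h`
(`u_0 = u₀`), `p = Σ_{h≥0} p_h t^h` (p.1 l.51–60, p.2 l.1–33): for every `h ≥ 0`,
(4) `(h+1) u_{h+1} + Σ_{g=0}^{h} (u_g·∇) u_{h−g} = νΔu_h − ∇p_h` on `ℝ³`, (5) `div u_h = 0`, all
coefficients smooth («Assuming u₀(x) is smooth, then u_{i,h+1}(x) and F(x) are smooth functions»), and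
the print's SELECTION of the pressure coefficient among the solutions of `Δp_h = F` (§3 p.2 l.40–53: «In
the limit as V → ℝ³, assuming physically reasonable solutions where u₀(x) → 0 sufficiently quickly at
infinity: p_h(x) = −(1/4π)∫_V F(η)/‖η − x‖ d³η + c») typed by the property that characterises the
Newtonian potential up to the additive constant `c`: `∇p_h(x) → 0` as `|x| → ∞` (typed ≤ print).
[cite: ArandaIcardo2025, §2 (4)–(5) pp.1–2; §3 p.2 l.40–53] -/
structure IsTaylorSystem (ν : ℝ) (u₀ : E3 → E3) (U : ℕ → E3 → E3) (P : ℕ → E3 → ℝ) : Prop where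
  /-- `u_0 = u₀` (p.1 l.52). -/
  initial : U 0 = u₀
  /-- every `u_h` is smooth (p.2 l.33). -/
  smooth_velocity : ∀ h : ℕ, ContDiff ℝ ∞ (U h)
  /-- every `p_h` is smooth (p.2 l.33, «F(x) … smooth»; p_h its potential). -/
  smooth_pressure : ∀ h : ℕ, ContDiff ℝ ∞ (P h)
  /-- (4) p.2: `(h+1) u_{h+1} + Σ_{g=0}^{h} (u_g·∇)u_{h−g} = νΔu_h − ∇p_h`. -/
  momentum : ∀ (h : ℕ) (x : E3),
    ((h : ℝ) + 1) • U (h + 1) x + ∑ g ∈ Finset.range (h + 1), convect (U g) (U (h - g)) x =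
      ν • Δ (U h) x - gradient (P h) x
  /-- (5) p.2: `div u_h = 0`. -/
  divFree : ∀ h : ℕ, NSWave0.IsDivFree (U h)
  /-- §3 p.2 l.40–53: the Newtonian-potential selection, `∇p_h → 0` at infinity. -/
  pressure_decay : ∀ h : ℕ, Tendsto (fun x : E3 => gradient (P h) x) (cocompact E3) (𝓝 0)

/-! ## The claimed statements -/

/-- **CLAIMED UNIQUENESS** (title; abstract p.1; §3 p.2): for every `ν > 0` and every datum `u₀` (smooth,
divergence-free, Clay decay), any two smooth bounded-energy solutions of (1)–(3) on `ℝ³ × [0,∞)` with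
`f ≡ 0` issued from `u₀` coincide for all `t ≥ 0`. Direction OTHER (not one of Clay (A)–(D)).
[claim: ArandaIcardo2025, status: under-review] [cite: ArandaIcardo2025, abstract p.1 l.4–6; §3 p.2 l.34–64] -/
def ClaimedUniqueness : Prop :=
  ∀ ν : ℝ, 0 < ν → ∀ u₀ : E3 → E3, IsDatum u₀ →
    ∀ (u : ℝ → E3 → E3) (p : ℝ → E3 → ℝ) (v : ℝ → E3 → E3) (q : ℝ → E3 → ℝ),
      IsGlobalSolution ν u₀ u p → IsGlobalSolution ν u₀ v q → ∀ t : ℝ, 0 ≤ t → u t = v t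

/-- **CLAIMED EXISTENCE** (§5 «Conclusion» p.5 l.58–73, last sentence under all listed conditions): for
every `ν > 0` and every smooth, divergence-free, rapidly decreasing datum with `(u₀·∇)u₀ = 0` there is a
smooth bounded-energy solution of (1)–(3) with `f ≡ 0` on `ℝ³ × [0,∞)` («There exists a smooth (regular)
solution to the three-dimensional Navier–Stokes equations for all positive time»). (A)-shaped on the
RESTRICTED data class Δ4. [claim: ArandaIcardo2025, status: under-review] [cite: ArandaIcardo2025, §5 p.5 l.58–73] -/
def ClaimedExistence : Prop :=
  ∀ ν : ℝ, 0 < ν → ∀ u₀ : E3 → E3, IsDatum u₀ → ConvectiveZero u₀ →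
    ∃ (u : ℝ → E3 → E3) (p : ℝ → E3 → ℝ), IsGlobalSolution ν u₀ u p

/-- **CLAIMED DECAY** (§5 p.5 l.62–70 «the kinetic energy decays over time and: lim_{t→∞} ∫_{ℝ³}
|u(x,t)|² dx = 0»; p.5 l.33–56): along every smooth bounded-energy solution from a datum the energy is
non-increasing and tends to `0`. [claim: ArandaIcardo2025, status: under-review] [cite: ArandaIcardo2025, §5 p.5 l.62–70; p.5 l.33–56] -/
def ClaimedDecay : Prop :=
  ∀ ν : ℝ, 0 < ν → ∀ u₀ : E3 → E3, IsDatum u₀ →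
    ∀ (u : ℝ → E3 → E3) (p : ℝ → E3 → ℝ), IsGlobalSolution ν u₀ u p →
      (∀ s t : ℝ, 0 ≤ s → s ≤ t → energy u t ≤ energy u s) ∧ Tendsto (energy u) atTop (𝓝 0)

/-! ## The Steps -/

/-- **Step 1 — the ansatz / representation (§2 p.1 l.51–60; p.2 l.54–64)**: «The equations can be solved
in Taylor series form: u_i = u_{0i}(x) + Σ_{h=1}^∞ u_{i,h}(x) t^h, p = Σ_{h=0}^∞ p_h(x) t^h» — every smooth
bounded-energy solution issued from a datum is, for every `t ≥ 0` and `x`, the sum of a time-power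
series whose coefficients form a Taylor system (4)–(5) for `(ν, u₀)`. The implicit identification of a
solution with its formal time-Taylor expansion at `t = 0` that the uniqueness conclusion consumes.
LOAD-BEARING. [claim: ArandaIcardo2025, status: under-review] [cite: ArandaIcardo2025, §2 p.1 l.51–60; §3 p.2 l.54–64] -/
def Step_1 : Prop :=
  ∀ ν : ℝ, 0 < ν → ∀ u₀ : E3 → E3, IsDatum u₀ →
    ∀ (u : ℝ → E3 → E3) (p : ℝ → E3 → ℝ), IsGlobalSolution ν u₀ u p →
      ∃ (U : ℕ → E3 → E3) (P : ℕ → E3 → ℝ), IsTaylorSystem ν u₀ U P ∧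
        ∀ t : ℝ, 0 ≤ t → ∀ x : E3, HasSum (fun h : ℕ => (t ^ h) • U h x) (u t x)

/-- **Step 2 — the recursion is solvable (§2 p.2 l.1–33; §3 p.2 l.40–53)**: «Assuming u₀(x) is smooth,
then u_{i,h+1}(x) and F(x) are smooth functions», `p_h` = the Newtonian potential of
`F = −Σ_{g=0}^{h} div((u_g·∇)u_{h−g})`: for every `ν > 0` and every datum a Taylor system (4)–(5) exists.
[claim: ArandaIcardo2025, status: under-review] [cite: ArandaIcardo2025, §2 p.2 l.1–33; §3 p.2 l.40–53] -/
def Step_2 : Prop :=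
  ∀ ν : ℝ, 0 < ν → ∀ u₀ : E3 → E3, IsDatum u₀ →
    ∃ (U : ℕ → E3 → E3) (P : ℕ → E3 → ℝ), IsTaylorSystem ν u₀ U P

/-- **Step 3 — uniqueness of the coefficients (§3 p.2 l.35–39, l.54–55)**: «The solution of Δp_h = F is
unique (up to an additive constant), p_h(x) = f(x) + c ⇒ u_{i,h+1}(x) is unique»; «u_{0i} → u_{i,1}, p_0
→ u_{i,2}, p_1 → ⋯»: two Taylor systems for the same `(ν, u₀)` have the same velocity coefficients.
TRUE-type as typed (harmonic `p_h − p'_h` with gradient vanishing at infinity is constant — Liouville);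
not proved here. [claim: ArandaIcardo2025, status: under-review] [cite: ArandaIcardo2025, §3 p.2 l.35–39, l.54–55] -/
def Step_3 : Prop :=
  ∀ ν : ℝ, 0 < ν → ∀ u₀ : E3 → E3, IsDatum u₀ →
    ∀ (U : ℕ → E3 → E3) (P : ℕ → E3 → ℝ) (U' : ℕ → E3 → E3) (P' : ℕ → E3 → ℝ),
      IsTaylorSystem ν u₀ U P → IsTaylorSystem ν u₀ U' P' → U = U'

/-- **Step 4 — convergence under the datum hypothesis (§4 pp.3–4)**: «If the convective acceleration is
assumed to be zero for the initial condition: (u·∇)u = 0 at t = 0 … u_{i,h+1} ≤ (1/(h+1))(Ā_{h+1}/h! +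
C̄_{h+1}D̄_{h+1}/(h−1)!!) … The coefficients Ā_{h+1}, C̄_{h+1}, and D̄_{h+1} belong to ℝ and depend only
on the initial conditions … there exist positive real numbers a, b, c, d, f such that: a ≥ C̄_h for all
even h, … Σ_h μ_{i,h} t^h ≤ N(t) … N(t) converges for all t ∈ ℝ»: for every datum with `(u₀·∇)u₀ = 0`
and every Taylor system, the velocity series converges at every `t ∈ ℝ` and `x`.
[claim: ArandaIcardo2025, status: under-review] [cite: ArandaIcardo2025, §4 p.3 l.1–59; p.3 l.60–p.4 l.76] -/
def Step_4 : Prop :=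
  ∀ ν : ℝ, 0 < ν → ∀ u₀ : E3 → E3, IsDatum u₀ → ConvectiveZero u₀ →
    ∀ (U : ℕ → E3 → E3) (P : ℕ → E3 → ℝ), IsTaylorSystem ν u₀ U P →
      ∀ (t : ℝ) (x : E3), Summable (fun h : ℕ => (t ^ h) • U h x)

/-- **Step 5 — the sum solves (IMPLICIT between §4 and §5 p.5 l.73; existence reading of p.1 l.51 «The
equations can be solved in Taylor series form»)**: if the velocity series of a Taylor system converges for
all `t ≥ 0`, its sum is a smooth bounded-energy solution of (1)–(3) with `f ≡ 0` on `ℝ³ × [0,∞)` for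
some pressure (term-wise differentiation, smoothness of the sum in `(t,x)`, bounded energy — nowhere
printed). [claim: ArandaIcardo2025, status: under-review] [cite: ArandaIcardo2025, §5 p.5 l.73; §2 p.1 l.51] -/
def Step_5 : Prop :=
  ∀ ν : ℝ, 0 < ν → ∀ u₀ : E3 → E3, IsDatum u₀ →
    ∀ (U : ℕ → E3 → E3) (P : ℕ → E3 → ℝ), IsTaylorSystem ν u₀ U P →
      (∀ t : ℝ, 0 ≤ t → ∀ x : E3, Summable (fun h : ℕ => (t ^ h) • U h x)) →
        ∃ p : ℝ → E3 → ℝ, IsGlobalSolution ν u₀ (fun t x => ∑' h : ℕ, (t ^ h) • U h x) p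

/-- **Step 6 — the energy law (p.4 l.77–p.5 l.35)**: «½ d/dt ∫|u|² dx + ν∫|∇u|² dx = 0 … dE/dt =
−ν∫|∇u|² dx ≤ 0. This shows that the kinetic energy does not increase», typed in integrated form along
every smooth bounded-energy solution from a datum: `E(t) ≤ E(s)` for `0 ≤ s ≤ t`. TRUE-type (Leray's
energy inequality) under integrability of `∇u`, `|u|³`, `p u` which the print does not state; not
proved here. [claim: ArandaIcardo2025, status: under-review] [cite: ArandaIcardo2025, p.4 l.77–p.5 l.35] -/
def Step_6 : Prop :=
  ∀ ν : ℝ, 0 < ν → ∀ u₀ : E3 → E3, IsDatum u₀ →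
    ∀ (u : ℝ → E3 → E3) (p : ℝ → E3 → ℝ), IsGlobalSolution ν u₀ u p →
      ∀ s t : ℝ, 0 ≤ s → s ≤ t → energy u t ≤ energy u s

/-- **Step 7 — decay (p.5 l.36–56)**: «Since E(t) is decreasing and bounded below by 0, it converges …
∫₀^∞∫|∇u(x,t)|² dx dt < ∞ … Moreover, assuming some additional regularity (such as the global existence
of a smooth solution, which is not yet proven in general), one can deduce that: lim_{t→∞} ‖u(·,t)‖_{L²}
= 0»: along every smooth bounded-energy solution from a datum the energy tends to `0`. TRUE-type
(L²-decay on `ℝ³`); hedged in print. [claim: ArandaIcardo2025, status: under-review] [cite: ArandaIcardo2025, p.5 l.36–56] -/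
def Step_7 : Prop :=
  ∀ ν : ℝ, 0 < ν → ∀ u₀ : E3 → E3, IsDatum u₀ →
    ∀ (u : ℝ → E3 → E3) (p : ℝ → E3 → ℝ), IsGlobalSolution ν u₀ u p →
      Tendsto (energy u) atTop (𝓝 0)

/-! ## Kernel compositions (the paper's chains) -/

/-- **COMPOSITION, uniqueness chain (§2 ansatz + §3)**: representation (Step 1) and uniqueness of the
coefficients (Step 3) give the claimed uniqueness — two solutions from the same datum are, for `t ≥ 0`,
sums of series with the same velocity coefficients. [cite: ArandaIcardo2025, §3 p.2 l.34–64] -/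
theorem claimU_of_steps (h₁ : Step_1) (h₃ : Step_3) : ClaimedUniqueness := by
  intro ν hν u₀ hd u p v q hu hv t ht
  obtain ⟨U, P, hU, hsu⟩ := h₁ ν hν u₀ hd u p hu
  obtain ⟨U', P', hU', hsv⟩ := h₁ ν hν u₀ hd v q hv
  have hUU' : U = U' := h₃ ν hν u₀ hd U P U' P' hU hU'
  subst hUU'
  funext x
  exact (hsu t ht x).unique (hsv t ht x)

/-- **COMPOSITION, existence chain (§2 + §4 + §5)**: a Taylor system exists (Step 2), its velocity series
converges under `(u₀·∇)u₀ = 0` (Step 4), and the sum solves (Step 5).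
[cite: ArandaIcardo2025, §4 pp.3–4; §5 p.5 l.71–73] -/
theorem claimE_of_steps (h₂ : Step_2) (h₄ : Step_4) (h₅ : Step_5) : ClaimedExistence := by
  intro ν hν u₀ hd hc
  obtain ⟨U, P, hT⟩ := h₂ ν hν u₀ hd
  obtain ⟨p, hp⟩ := h₅ ν hν u₀ hd U P hT fun t _ x => h₄ ν hν u₀ hd hc U P hT t x
  exact ⟨_, p, hp⟩

/-- **COMPOSITION, decay chain (pp.4–5)**: Steps 6 and 7 are the two clauses of the claimed decay.
[cite: ArandaIcardo2025, §5 p.5 l.62–70] -/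
theorem claimD_of_steps (h₆ : Step_6) (h₇ : Step_7) : ClaimedDecay :=
  fun ν hν u₀ hd u p hu => ⟨h₆ ν hν u₀ hd u p hu, h₇ ν hν u₀ hd u p hu⟩

/-! ## Clay plumbing -/

/-- The print's «solution» class is token for token Clay's: `IsGlobalSolution ν u₀ u p` for some `(u, p)`
iff `clayR3.Solvable ν 0 u₀`. [cite: FeffermanClay2006, (A) p. 2] -/
theorem isGlobalSolution_iff_solvable (ν : ℝ) (u₀ : E3 → E3) :
    (∃ (u : ℝ → E3 → E3) (p : ℝ → E3 → ℝ), IsGlobalSolution ν u₀ u p) ↔ clayR3.Solvable ν 0 u₀ :=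
  Iff.rfl

/-- **The claimed existence is Clay (A) restricted to the data class `{(u₀·∇)u₀ = 0}`** (Δ4): it reads
`∀ ν > 0, ∀ u₀` smooth, divergence-free, of class (4), with `(u₀·∇)u₀ = 0`, `clayR3.Solvable ν 0 u₀`.
[cite: ArandaIcardo2025, §5 p.5 l.58–73] [cite: FeffermanClay2006, (A) p. 2] -/
theorem claimedExistence_iff :
    ClaimedExistence ↔
      ∀ ν : ℝ, 0 < ν → ∀ u₀ : E3 → E3, ContDiff ℝ ∞ u₀ → NSWave0.IsDivFree u₀ →
        HasRapidSpatialDecay u₀ → ConvectiveZero u₀ → clayR3.Solvable ν 0 u₀ := by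
  constructor
  · intro h ν hν u₀ hs hdiv hdec hc
    exact (isGlobalSolution_iff_solvable ν u₀).1 (h ν hν u₀ ⟨hs, hdiv, hdec⟩ hc)
  · intro h ν hν u₀ hd hc
    exact (isGlobalSolution_iff_solvable ν u₀).2 (h ν hν u₀ hd.1 hd.2.1 hd.2.2 hc)

/-- Clay (A) implies the claimed existence (the restricted class is a subclass of (4)); the converse is
neither printed nor typable (Δ4). [cite: ArandaIcardo2025, §5 p.5 l.58–73] [cite: FeffermanClay2006, (A) p. 2] -/
theorem claimedExistence_of_clay (h : clayR3.Regularity) : ClaimedExistence :=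
  fun ν hν u₀ hd _ => (isGlobalSolution_iff_solvable ν u₀).2 (h ν hν u₀ hd.1 hd.2.1 hd.2.2)

/-! ## In-file discharge of the CLAIMED UNIQUENESS (D-0026; statement unchanged)

The uniqueness sentence of the title/abstract is, at Clay's grain, a THEOREM of the classical
theory (not by the paper's formal power-series argument, whose Step 1 is refuted summit-side):
a Clay-class solution is Leray–Hopf (Tao 2013, Lemma 8.1) and bounded (Cor. 11.1), so
Prodi–Serrin weak–strong uniqueness identifies any second Clay-class solution with it
(tree `IsNavierStokesSolution.ae_eq_of_isLerayHopfOn`, `isLerayHopfOn_of_finiteEnergy`). -/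

/-- **The claimed uniqueness HOLDS** (as a statement; abstract p.1 l.4–6, §3 p.2): for `ν > 0` and a
smooth divergence-free rapidly decaying datum, two smooth bounded-energy solutions of (1)–(3) on
`ℝ³ × [0,∞)` with `f ≡ 0` coincide at every `t ≥ 0` — by the tree's Clay-class/Leray–Hopf
weak–strong uniqueness (Tao 2013 Lemma 8.1 + Cor. 11.1 + Prodi–Serrin), NOT by the paper's §3
time-power-series argument (its `Step_1` is kernel-false summit-side). At `t = 0` both slices
equal `u₀`; for `t > 0` the a.e. identity upgrades to equality by continuity of the smooth slices.
[cite: ArandaIcardo2025, abstract p.1 l.4–6; §3 p.2 l.34–64] -/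
theorem claimedUniqueness_holds : ClaimedUniqueness := by
  intro ν hν u₀ hd u p v q hu hv t ht
  obtain ⟨hus, hps, hns, hE⟩ := hu
  obtain ⟨hvs, hqs, hnsv, hEv⟩ := hv
  rcases ht.eq_or_lt with h0 | htpos
  · rw [← h0, hns.initial, hnsv.initial]
  · -- the second solution is Leray–Hopf on `[0, t)` from `u₀`
    have hclv : IsClassicalNSSolutionOn (Icc 0 t) ν 0 v q := hnsv.isClassicalNSSolutionOn_Icc hvs hqs htpos
    have hfev : ∃ A : ENNReal, A < ⊤ ∧ ∀ s ∈ Icc 0 t, ∫⁻ x, ‖v s x‖ₑ ^ 2 ≤ A := by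
      obtain ⟨C, hC, hb⟩ := hEv
      exact ⟨C, hC, fun s hs => hb s hs.1⟩
    have hLH : IsLerayHopfOn t ν 0 u₀ v := by
      have h := (isLerayHopfOn_of_finiteEnergy hclv hν htpos hfev).1
      rwa [hnsv.initial] at h
    -- weak–strong uniqueness against the first (Clay-class) solution
    have hae : v t =ᵐ[volume] u t :=
      hns.ae_eq_of_isLerayHopfOn hν htpos hd.2.2 hus hps hE hLH t ⟨htpos, le_rfl⟩
    have hus' : IsSmoothSpaceTimeOn (Ici 0) u := hus
    have hvs' : IsSmoothSpaceTimeOn (Ici 0) v := hvs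
    have huc : Continuous (u t) := (hus'.contDiff_slice (mem_Ici.2 ht)).continuous
    have hvc : Continuous (v t) := (hvs'.contDiff_slice (mem_Ici.2 ht)).continuous
    exact ((Continuous.ae_eq_iff_eq volume hvc huc).1 hae).symm

/-! ## In-file discharge of Step 6 (D-0026; statement unchanged)

The energy law of p.4 l.77–p.5 l.35 is, at Clay's grain, a THEOREM of the classical theory: a smooth
bounded-energy solution on `ℝ³ × [0,∞)` lies in the energy class on every slab `[0,t]` — `∇u ∈ L²_{t,x}`
(Tao 2013, Lemma 8.1; tree `IsClassicalNSSolutionOn.energyClass_of_finiteEnergy` with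
`tao_finite_energy_smooth_energy_bound_holds`) and hence `u ∈ L³_{t,x}`
(`IsClassicalNSSolutionOn.lintegral_enorm_pow_three_lt_top`) — so Leray's identity
`½‖u(t)‖₂² + ν∫ₛᵗ∫|∇u|² = ½‖u(s)‖₂²` (tree `IsClassicalNSSolutionOn.energyEq_of_finiteEnergy`) holds
and gives `E(t) ≤ E(s)`. The integrability of `∇u`, `|u|³`, `p u` that the print does not state is thus
SUPPLIED by Lemma 8.1, not assumed. -/

/-- **Step 6 HOLDS — kernel** (p.4 l.77–p.5 l.35 «dE/dt = −ν∫|∇u|² dx ≤ 0. This shows that the kinetic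
energy does not increase»): along every smooth bounded-energy solution of (1)–(3) on `ℝ³ × [0,∞)` with
`f ≡ 0` from a datum of the class, `energy u t ≤ energy u s` for `0 ≤ s ≤ t` — by Tao 2013 Lemma 8.1
(finite-energy smooth solutions are in the energy class) and Leray's energy identity, both in the tree;
the datum hypothesis is not used. [cite: ArandaIcardo2025, p.4 l.77–p.5 l.35] [cite: Tao2011, Lemma 8.1] -/
theorem step_6_holds : Step_6 := by
  intro ν hν u₀ _hd u p hu s t hs hst
  obtain ⟨hus, hps, hns, hE⟩ := hu
  rcases hst.eq_or_lt with h | hlt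
  · rw [h]
  have ht0 : 0 < t := hs.trans_lt hlt
  have hcl : IsClassicalNSSolutionOn (Icc 0 t) ν 0 u p := hns.isClassicalNSSolutionOn_Icc hus hps ht0
  have hfe : ∃ A : ℝ≥0∞, A < ⊤ ∧ ∀ τ ∈ Icc 0 t, ∫⁻ x, ‖u τ x‖ₑ ^ 2 ≤ A := by
    obtain ⟨C, hC, hb⟩ := hE
    exact ⟨C, hC, fun τ hτ => hb τ hτ.1⟩
  obtain ⟨A, hAt, hA, -, hgrad⟩ :=
    hcl.energyClass_of_finiteEnergy tao_finite_energy_smooth_energy_bound_holds hν ht0 hfe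
  have hu₃ := hcl.lintegral_enorm_pow_three_lt_top hAt hA hgrad
  have hid := hcl.energyEq_of_finiteEnergy tao_pressure_normalisation_holds
    tao2011_pressureTerm_estimate_holds hν ht0 hAt hA hgrad hu₃ hs hlt.le le_rfl
  have hD : 0 ≤ ν * (∫⁻ τ in Ioo s t, ∫⁻ x,
      ENNReal.ofReal (frobeniusNormSq (fderiv ℝ (u τ) x))).toReal :=
    mul_nonneg hν.le ENNReal.toReal_nonneg
  have hKE : VectorCalculus.kineticEnergy (u t) ≤ VectorCalculus.kineticEnergy (u s) := by linarith
  have hmem : ∀ τ ∈ Icc 0 t, MemLp (u τ) 2 volume := fun τ hτ =>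
    memLp_two_of_lintegral_lt_top (hcl.contDiff_velocity hτ).continuous ((hA τ hτ).trans_lt hAt.lt_top)
  change eEnergy (u t) ≤ eEnergy (u s)
  rw [eEnergy_eq_ofReal _ (hmem t ⟨ht0.le, le_rfl⟩), eEnergy_eq_ofReal _ (hmem s ⟨hs, hlt.le⟩)]
  gcongr

/-- **Step 7 HOLDS — kernel** (p.5 l.36–56 «Since E(t) is decreasing and bounded below by 0, it converges … one
can deduce that: lim_{t→∞} ‖u(·,t)‖_{L²} = 0»): along every smooth bounded-energy solution of (1)–(3) on
`ℝ³ × [0,∞)` with `f ≡ 0` from a datum of the class, the kinetic energy tends to zero — Masuda 1984 Thm. 2 /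
Kato 1984 §4 for this class, a tree THEOREM (`Literature.Analysis.FluidPDE.IsNavierStokesSolution.tendsto_lintegral_enorm_sq_atTop`:
Oseen representation + heat low-pass of the Duhamel term through the energy + Tao's energy equality and good
times + Ledoux's defect bound; no rate — none exists on `L²` data). Only the rapid decay of the datum is used
from `IsDatum`. [cite: ArandaIcardo2025, p.5 l.36–56] [cite: Masuda1984, Thm. 2] -/
theorem step_7_holds : Step_7 := by
  intro ν hν u₀ hd u p hu
  obtain ⟨hus, hps, hns, hE⟩ := hu
  exact hns.tendsto_lintegral_enorm_sq_atTop hν hd.2.2 hus hps hE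

/-- **The CLAIMED DECAY holds — kernel** (§5 p.5 l.62–70 «the kinetic energy decays over time and:
lim_{t→∞} ∫_{ℝ³} |u(x,t)|² dx = 0»): along every smooth bounded-energy solution from a datum of the class
the energy is non-increasing (Step 6, Tao 2013 Lemma 8.1 / Leray) AND tends to zero (Step 7, Masuda 1984 /
Kato 1984) — both steps are now theorems of the tree, so the decay half of the paper's statement is TRUE by
the printed composition `claimD_of_steps` (for the printed reason in Step 6; for Step 7 by the classical
theorem the print only gestures at). The existence/uniqueness halves are untouched (`ClaimedExistence` lives on
the `ConvectiveZero` class, row #106). [cite: ArandaIcardo2025, §5 p.5 l.62–70] [cite: Masuda1984, Thm. 2] -/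
theorem claimedDecay_holds : ClaimedDecay :=
  claimD_of_steps step_6_holds step_7_holds

end Literature.Claims.NS.ArandaIcardo2025

end

-- WHAT THIS IS NOT: not a claim about NS regularity or blow-up; not a claim about any author beyond the
-- typed locator.
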